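import Mathlib
import Summits.AtomisticToContinuum.Crystallization.Theses.PhononSlackCertificates
import Summits.AtomisticToContinuum.Crystallization.Theorems.PhononSlackCertificatesHullBridge
import Summits.AtomisticToContinuum.Crystallization.Theorems.PhononSlackCertificatesPeriodicGivenLayered
import Summits.AtomisticToContinuum.Crystallization.Theorems.PhononSlackCertificatesWindowOptimality
import Literature.MathematicalPhysics.StatisticalMechanics.LennardJonesClusters
import Literature.Geometry.DiscreteGeometry.TwoShellPatterns

/-!
# Crux `PhononSlackCertificates.NearFarGlueR` (stmt-AtomisticToContinuum-14970), line `Sketch`: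
what the ROUTE consumes of the crux — two FRACTION statements about ground states close the summit

Continuation lead c6.  The crux `NearFarGlueR : FarFieldGapR → NearFieldConvexity →
CoerciveTwoShellGap` exists to feed `CoerciveTwoShellGap` into the deciding theorem `closes`, whose
only consumer of it is `HullBridge`; and the landed proof of `HullBridge`
(`HullBridgeExact.hullBridge_of_layeredGluing`) consumes `CoerciveTwoShellGap` ONLY through
`stub_badFraction` — the bad FRACTION of Lennard-Jones ground states tends to zero — and
`NearFieldConvexity` ONLY through `stub_nonLayeredFraction` — for every `η > 0` the fraction of
particles whose `2`-ball is not `η`-layered tends to zero.  Every other item of the route is proved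
(`PeriodicGivenLayered_of`, `windowOptimality_proof`, `HullCriterion_holds`, `CrysEnergyLimit_holds`,
`stub_layeredGluing`).  Hence (§1–§2) the whole sub-problem `Crystallization` follows from the two
LOCAL, QUALITATIVE statements about ground states alone —

  (F1) `#{i : particle i of x^N is not 1/20-good}/N → 0`,
  (F2) `∀ η > 0, #{i : the 2-ball of x^N_i is not η-layered}/N → 0`

(`crystallization_of_fractions`; radius-`3/2` and radius-`2` order of ground states, no rate, no
energy inequality, no separation parameter), and (§3) the route's quantitative engine
`CoerciveTwoShellGap ∧ NearFieldConvexity` is one sufficient condition for them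
(`crystallization_of_coerciveTwoShellGap_of_nearFieldConvexity`): the far field `FarFieldGapR` and
the glue `NearFarGlueR` are not on this path at all, and of the linear coercivity of the target only
its `o(N)` corollary along ground states is used.  For the planner this is the exact measure of how
much weaker than the typed crux the route's need is (seventh handback of the residual
`stub_tightContactGap`).  All `[folklore]`.
-/

noncomputable section

namespace Summit.AtomisticToContinuum.Crystallization.Theorems.PhononSlackCertificatesNearFarGlueR

open Literature.MathematicalPhysics.StatisticalMechanics
open Literature.Geometry.DiscreteGeometry
open Summit.AtomisticToContinuum.Crystallization.Theses.PhononSlackCertificates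
open Summit.AtomisticToContinuum.Crystallization.Theorems.PrestressSplitKorn (LayeredNear stub_layeredGluing)
open scoped BigOperators Classical
open Filter Topology

/-! ## §1 Layered windows from the two fraction statements -/

/-- **Layered windows of every ground-state sequence from (F1) and (F2).**  If along every sequence
of Lennard-Jones ground states the bad fraction and, for every `η > 0`, the non-`η`-layered fraction
tend to zero, then every ground-state sequence has layered windows at every scale (the statement
`LayeredWindows` of the route) — composition of the landed `stub_cleanCentres`,
`stub_windowsOfGluing` and the proved gluing lemma `stub_layeredGluing`. [folklore] -/
theorem layeredWindows_of_fractions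
    (hbad : ∀ x : (N : ℕ) → (Fin N → EuclideanSpace ℝ (Fin 3)),
      (∀ N, IsGroundState lennardJones (x N)) →
      Tendsto (fun N : ℕ =>
        (Nat.card {i : Fin N // ¬ IsTwoShellGood (1 / 20) (47 / 50) 1 (x N) i} : ℝ) / N) atTop (𝓝 0))
    (hnl : ∀ x : (N : ℕ) → (Fin N → EuclideanSpace ℝ (Fin 3)),
      (∀ N, IsGroundState lennardJones (x N)) → ∀ η : ℝ, 0 < η →
      Tendsto (fun N : ℕ =>
        ((Finset.univ.filter fun i : Fin N => ¬ LayeredNear η (x N) i).card : ℝ) / N) atTop (𝓝 0)) :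
    LayeredWindows := by
  intro x hx
  exact HullBridgeExact.stub_windowsOfGluing stub_layeredGluing x hx
    (fun η hη R' => HullBridgeExact.stub_cleanCentres x hx (hbad x hx) (hnl x hx) hη R')

/-! ## §2 The summit's sub-problem from the two fraction statements -/

/-- **`Crystallization` from (F1) and (F2) alone.**  The body of the deciding theorem `closes`, run
with `LayeredWindows` obtained from §1 instead of from `NearFarGlueR`/`HullBridge`: periodic windows
by the proved `PeriodicGivenLayered_of`, conjunct (ii) by `HullCriterion_holds`, conjunct (i) by the
proved `windowOptimality_proof`, `CrysEnergyLimit_holds` and `LennardJonesGroundStatesExist_holds`.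
[folklore] -/
theorem crystallization_of_fractions
    (hbad : ∀ x : (N : ℕ) → (Fin N → EuclideanSpace ℝ (Fin 3)),
      (∀ N, IsGroundState lennardJones (x N)) →
      Tendsto (fun N : ℕ =>
        (Nat.card {i : Fin N // ¬ IsTwoShellGood (1 / 20) (47 / 50) 1 (x N) i} : ℝ) / N) atTop (𝓝 0))
    (hnl : ∀ x : (N : ℕ) → (Fin N → EuclideanSpace ℝ (Fin 3)),
      (∀ N, IsGroundState lennardJones (x N)) → ∀ η : ℝ, 0 < η →
      Tendsto (fun N : ℕ =>
        ((Finset.univ.filter fun i : Fin N => ¬ LayeredNear η (x N) i).card : ℝ) / N) atTop (𝓝 0)) :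
    _root_.Crystallization := by
  have hLW : LayeredWindows := layeredWindows_of_fractions hbad hnl
  have hPGL : PeriodicGivenLayered := LayeredHull.PeriodicGivenLayered_of
  have hPW : PeriodicWindows := fun y hy => hPGL y hy (hLW y hy)
  have hpos : IsCrystallizing lennardJones 3 := HullCriterion_holds hPW
  have hWO : WindowOptimality := windowOptimality_proof
  obtain ⟨x, hx⟩ : ∃ x : (N : ℕ) → (Fin N → EuclideanSpace ℝ (Fin 3)), ∀ N,
      IsGroundState lennardJones (x N) :=
    ⟨fun N => (LennardJonesGroundStatesExist_holds N).choose,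
      fun N => (LennardJonesGroundStatesExist_holds N).choose_spec⟩
  obtain ⟨P, hP⟩ := hPW x hx
  have hleast : IsLeast (Set.range fun Q : PeriodicConfiguration 3 => Q.energyPerParticle lennardJones)
      (P.energyPerParticle lennardJones) := hWO x hx P hP
  have hinf : (⨅ Q : PeriodicConfiguration 3, Q.energyPerParticle lennardJones) =
      P.energyPerParticle lennardJones := hleast.csInf_eq
  have hlim : Tendsto (fun N : ℕ => groundStateEnergy lennardJones 3 N / N) atTop
      (𝓝 (P.energyPerParticle lennardJones)) := by
    have h0 : CrysEnergyLimit := CrysEnergyLimit_holds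
    unfold CrysEnergyLimit at h0
    rw [hinf] at h0
    exact h0
  exact ⟨⟨P, hleast, hlim⟩, hpos⟩

/-- **Registered sub-goal `stub_routeNeeds` of the line `Sketch`** (the statement of
`crystallization_of_fractions`). [folklore] -/
theorem stub_routeNeeds :
    (∀ x : (N : ℕ) → (Fin N → EuclideanSpace ℝ (Fin 3)),
      (∀ N, IsGroundState lennardJones (x N)) →
      Tendsto (fun N : ℕ =>
        (Nat.card {i : Fin N // ¬ IsTwoShellGood (1 / 20) (47 / 50) 1 (x N) i} : ℝ) / N) atTop (𝓝 0)) →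
    (∀ x : (N : ℕ) → (Fin N → EuclideanSpace ℝ (Fin 3)),
      (∀ N, IsGroundState lennardJones (x N)) → ∀ η : ℝ, 0 < η →
      Tendsto (fun N : ℕ =>
        ((Finset.univ.filter fun i : Fin N => ¬ LayeredNear η (x N) i).card : ℝ) / N) atTop (𝓝 0)) →
    _root_.Crystallization :=
  crystallization_of_fractions

/-! ## §3 The route's quantitative engine is one sufficient condition for the fractions -/

/-- (F1) from the target: along ground states `CoerciveTwoShellGap` gives bad fraction `→ 0`
(the landed `HullBridgeExact.stub_badFraction`). [folklore] -/
theorem badFraction_of_coerciveTwoShellGap (hCG : CoerciveTwoShellGap)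
    (x : (N : ℕ) → (Fin N → EuclideanSpace ℝ (Fin 3))) (hx : ∀ N, IsGroundState lennardJones (x N)) :
    Tendsto (fun N : ℕ =>
      (Nat.card {i : Fin N // ¬ IsTwoShellGood (1 / 20) (47 / 50) 1 (x N) i} : ℝ) / N) atTop (𝓝 0) :=
  HullBridgeExact.stub_badFraction hCG x hx

/-- (F2) from the near field and (F1): along ground states with bad fraction `→ 0`,
`NearFieldConvexity` gives non-`η`-layered fraction `→ 0` for every `η > 0` (the landed
`HullBridgeExact.stub_nonLayeredFraction`). [folklore] -/
theorem nonLayeredFraction_of_nearFieldConvexity (hNF : NearFieldConvexity)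
    (x : (N : ℕ) → (Fin N → EuclideanSpace ℝ (Fin 3))) (hx : ∀ N, IsGroundState lennardJones (x N))
    (hbad : Tendsto (fun N : ℕ =>
      (Nat.card {i : Fin N // ¬ IsTwoShellGood (1 / 20) (47 / 50) 1 (x N) i} : ℝ) / N) atTop (𝓝 0))
    {η : ℝ} (hη : 0 < η) :
    Tendsto (fun N : ℕ =>
      ((Finset.univ.filter fun i : Fin N => ¬ LayeredNear η (x N) i).card : ℝ) / N) atTop (𝓝 0) :=
  HullBridgeExact.stub_nonLayeredFraction hNF x hx hbad hη

/-- **`CoerciveTwoShellGap → NearFieldConvexity → Crystallization`**: the target and the near field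
close the sub-problem by themselves — the far field `FarFieldGapR` and the glue `NearFarGlueR` are
not on this path, and of the target only its ground-state corollary (F1) is used. [folklore] -/
theorem crystallization_of_coerciveTwoShellGap_of_nearFieldConvexity (hCG : CoerciveTwoShellGap)
    (hNF : NearFieldConvexity) : _root_.Crystallization :=
  crystallization_of_fractions (fun x hx => badFraction_of_coerciveTwoShellGap hCG x hx)
    (fun x hx _ hη => nonLayeredFraction_of_nearFieldConvexity hNF x hx
      (badFraction_of_coerciveTwoShellGap hCG x hx) hη)

/-- **The crux on this path**: `FarFieldGapR → NearFieldConvexity → NearFarGlueR → Crystallization`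
(the three live energy items of the route, nothing else assumed). [folklore] -/
theorem crystallization_of_nearFarGlueR (hF : FarFieldGapR) (hNF : NearFieldConvexity)
    (hG : NearFarGlueR) : _root_.Crystallization :=
  crystallization_of_coerciveTwoShellGap_of_nearFieldConvexity (hG hF hNF) hNF

/-! ## §4 Appendix (c6): the QUALITATIVE coercivity that suffices for (F1)

The cheapest energy statement giving (F1) is not the linear `CoerciveTwoShellGap` but its
qualitative shadow: for every bad FRACTION `ε > 0` a gap `c(ε) > 0` per particle.  Together with the
proved `o(N)` excess of ground states (`squeeze_tendsto_excess_div`) it yields (F1), hence, with the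
near field, `Crystallization`; and the linear target implies it with `c := g·ε`. -/

/-- **(F1) from QUALITATIVE coercivity.**  If for every separation `δ > 0` and every fraction `ε > 0`
there is `c > 0` such that every `δ`-separated configuration with at least `ε·N` bad particles has
energy at least `N·(e* + c)`, then along every sequence of Lennard-Jones ground states the bad
fraction tends to zero (ground states are uniformly separated, `LennardJonesMinimalDistance_holds`,
and have excess `o(N)`, `squeeze_tendsto_excess_div`). [folklore] -/
theorem badFraction_of_qualCoercive
    (hQ : ∀ δ : ℝ, 0 < δ → ∀ ε : ℝ, 0 < ε → ∃ c : ℝ, 0 < c ∧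
      ∀ (N : ℕ) (x : Fin N → EuclideanSpace ℝ (Fin 3)),
        (∀ i j : Fin N, i ≠ j → δ ≤ dist (x i) (x j)) →
        ε * (N : ℝ) ≤ (Nat.card {i : Fin N // ¬ IsTwoShellGood (1 / 20) (47 / 50) 1 x i} : ℝ) →
        (N : ℝ) * ((⨅ Q : PeriodicConfiguration 3, Q.energyPerParticle lennardJones) + c) ≤
          interactionEnergy lennardJones x)
    (x : (N : ℕ) → (Fin N → EuclideanSpace ℝ (Fin 3))) (hx : ∀ N, IsGroundState lennardJones (x N)) :
    Tendsto (fun N : ℕ =>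
      (Nat.card {i : Fin N // ¬ IsTwoShellGood (1 / 20) (47 / 50) 1 (x N) i} : ℝ) / N) atTop (𝓝 0) := by
  obtain ⟨δ, hδ, hsep⟩ := LennardJonesMinimalDistance_holds
  have hexc := PrestressSplitKorn.squeeze_tendsto_excess_div x hx
  rw [Metric.tendsto_atTop] at hexc ⊢
  intro ε hε
  obtain ⟨c, hc, hgap⟩ := hQ δ hδ ε hε
  obtain ⟨N₀, hN₀⟩ := hexc c hc
  refine ⟨max N₀ 1, fun N hN => ?_⟩
  have hNN₀ : N₀ ≤ N := le_trans (le_max_left _ _) hN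
  have hN1 : 1 ≤ N := le_trans (le_max_right _ _) hN
  have hNpos : (0 : ℝ) < N := by exact_mod_cast hN1
  have hsmall := hN₀ N hNN₀
  rw [Real.dist_eq, sub_zero] at hsmall ⊢
  set B : ℝ := (Nat.card {i : Fin N // ¬ IsTwoShellGood (1 / 20) (47 / 50) 1 (x N) i} : ℝ) with hB
  have hB0 : 0 ≤ B := Nat.cast_nonneg _
  rw [abs_of_nonneg (div_nonneg hB0 hNpos.le)]
  -- if the bad fraction were `≥ ε`, the gap `c·N` would contradict the `o(N)` excess
  by_contra hge
  have hge' : ε * (N : ℝ) ≤ B := by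
    have := not_lt.1 hge
    rwa [le_div_iff₀ hNpos] at this
  have hE := hgap N (x N) (hsep N (x N) (hx N)) hge'
  have habs : (interactionEnergy lennardJones (x N) -
      (N : ℝ) * (⨅ Q : PeriodicConfiguration 3, Q.energyPerParticle lennardJones)) / N < c :=
    lt_of_abs_lt hsmall
  rw [div_lt_iff₀ hNpos] at habs
  nlinarith

/-- **`Crystallization` from qualitative coercivity and the near field** — a sufficient re-cut of the
route's energy engine (`crystallization_of_fractions` with (F1) from `badFraction_of_qualCoercive` and
(F2) from `nonLayeredFraction_of_nearFieldConvexity`). [folklore] -/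
theorem crystallization_of_qualCoercive_of_nearFieldConvexity
    (hQ : ∀ δ : ℝ, 0 < δ → ∀ ε : ℝ, 0 < ε → ∃ c : ℝ, 0 < c ∧
      ∀ (N : ℕ) (x : Fin N → EuclideanSpace ℝ (Fin 3)),
        (∀ i j : Fin N, i ≠ j → δ ≤ dist (x i) (x j)) →
        ε * (N : ℝ) ≤ (Nat.card {i : Fin N // ¬ IsTwoShellGood (1 / 20) (47 / 50) 1 x i} : ℝ) →
        (N : ℝ) * ((⨅ Q : PeriodicConfiguration 3, Q.energyPerParticle lennardJones) + c) ≤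
          interactionEnergy lennardJones x)
    (hNF : NearFieldConvexity) : _root_.Crystallization :=
  crystallization_of_fractions (fun x hx => badFraction_of_qualCoercive hQ x hx)
    (fun x hx _ hη => nonLayeredFraction_of_nearFieldConvexity hNF x hx
      (badFraction_of_qualCoercive hQ x hx) hη)

/-- **The linear target implies the qualitative coercivity** (`c := g·ε`). [folklore] -/
theorem qualCoercive_of_coerciveTwoShellGap (hCG : CoerciveTwoShellGap) :
    ∀ δ : ℝ, 0 < δ → ∀ ε : ℝ, 0 < ε → ∃ c : ℝ, 0 < c ∧
      ∀ (N : ℕ) (x : Fin N → EuclideanSpace ℝ (Fin 3)),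
        (∀ i j : Fin N, i ≠ j → δ ≤ dist (x i) (x j)) →
        ε * (N : ℝ) ≤ (Nat.card {i : Fin N // ¬ IsTwoShellGood (1 / 20) (47 / 50) 1 x i} : ℝ) →
        (N : ℝ) * ((⨅ Q : PeriodicConfiguration 3, Q.energyPerParticle lennardJones) + c) ≤
          interactionEnergy lennardJones x := by
  intro δ hδ ε hε
  obtain ⟨g, hg, hgap⟩ := hCG δ hδ
  refine ⟨g * ε, mul_pos hg hε, fun N x hsep hbad => ?_⟩
  have h := hgap N x hsep
  have h2 : g * (ε * (N : ℝ)) ≤ g * (Nat.card {i : Fin N // ¬ IsTwoShellGood (1 / 20) (47 / 50) 1 x i} : ℝ) :=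
    mul_le_mul_of_nonneg_left hbad hg.le
  nlinarith

/-- **Registered sub-goal `stub_qualEngine` of the line `Sketch`**: qualitative coercivity and the
near field close the sub-problem (the statement of
`crystallization_of_qualCoercive_of_nearFieldConvexity`). [folklore] -/
theorem stub_qualEngine :
    (∀ δ : ℝ, 0 < δ → ∀ ε : ℝ, 0 < ε → ∃ c : ℝ, 0 < c ∧
      ∀ (N : ℕ) (x : Fin N → EuclideanSpace ℝ (Fin 3)),
        (∀ i j : Fin N, i ≠ j → δ ≤ dist (x i) (x j)) →
        ε * (N : ℝ) ≤ (Nat.card {i : Fin N // ¬ IsTwoShellGood (1 / 20) (47 / 50) 1 x i} : ℝ) →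
        (N : ℝ) * ((⨅ Q : PeriodicConfiguration 3, Q.energyPerParticle lennardJones) + c) ≤
          interactionEnergy lennardJones x) →
    NearFieldConvexity → _root_.Crystallization :=
  crystallization_of_qualCoercive_of_nearFieldConvexity

end Summit.AtomisticToContinuum.Crystallization.Theorems.PhononSlackCertificatesNearFarGlueR

end
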